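import Mathlib

/-!
# TropicalLinks / InductiveStep — the chart subalgebras have fraction field `K` (abstract form)

Route `ResolutionOfSingularities/TropicalLinks`, crux `InductiveStep` (stmt-ResolutionOfSingularities-17233),
line `split`, brick FQ (producer brick for Stage 0 of `stub_mainLemma`).

Setting: `k ⊆ K` fields, `f' : Fin (n + 1) → K` homogeneous coordinates of a projective variety with
`f' 0 = 1`, so that `k[f'] = Algebra.adjoin k (Set.range f') ⊆ K` is the affine coordinate ring, and
the only "fraction field" hypothesis is that every `z ∈ K` is a quotient `a / b` of elements of
`k[f']` with `b ≠ 0`.  For an index `h` with `f' h ≠ 0` the chart subalgebra is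
`𝒞_h := k[f'_j · (f'_h)⁻¹ : j] ⊆ K`.

* `tropicalLinks_chart_mul_inv_pow_mem` — every `c ∈ k[f']` satisfies `c · ((f'_h)⁻¹) ^ D ∈ 𝒞_h` for
  some `D` (induction on `Algebra.adjoin`; `(f'_h)⁻¹ = f'_0 · (f'_h)⁻¹` is a generator of `𝒞_h`).
* `tropicalLinks_chart_isFractionRing_of_frac` — **`K = Frac 𝒞_h`, `𝒞_h` is of finite type over `k`,
  and `𝒞_0 = k[f']`.**  Fraction field: write `z = a / b` with `a, b ∈ k[f']`, pad numerator and
  denominator by a common power of `u = (f'_h)⁻¹ ≠ 0`; finite type: finitely many generators; the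
  `0`-th chart has generators `f'_j · 1⁻¹ = f'_j`.
-/

-- single-problem summit: the doubled namespace component `ResolutionOfSingularities` is forced
set_option linter.dupNamespace false

namespace Summit.ResolutionOfSingularities.ResolutionOfSingularities.Theorems

/-- **Clearing denominators into the chart (abstract form).** For fields `k ⊆ K`, coordinates
`f' : Fin (n + 1) → K` with `f' 0 = 1`, an index `h` and `u = (f'_h)⁻¹`, every element `c` of
`k[f'] = Algebra.adjoin k (Set.range f')` satisfies `c · u ^ D ∈ k[f'_j · u : j]` for some `D : ℕ`:
a generator `f'_j` needs `D = 1`, constants need `D = 0`, a sum is brought to the common exponent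
`D₁ + D₂` using the generator `u = f'_0 · u`, and for a product the exponents add. [folklore] -/
theorem tropicalLinks_chart_mul_inv_pow_mem
    (k : Type) [Field k] (K : Type) [Field K] [Algebra k K] (n : ℕ) (f' : Fin (n + 1) → K)
    (h0 : f' 0 = 1) (h : Fin (n + 1)) (c : K) (hc : c ∈ Algebra.adjoin k (Set.range f')) :
    ∃ D : ℕ, c * ((f' h)⁻¹) ^ D ∈
      Algebra.adjoin k (Set.range fun j : Fin (n + 1) => f' j * (f' h)⁻¹) := by
  set u : K := (f' h)⁻¹ with hu
  set S : Subalgebra k K := Algebra.adjoin k (Set.range fun j : Fin (n + 1) => f' j * u) with hS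
  -- the generators `f'_j · u`, in particular `u = f'_0 · u`
  have hgen : ∀ j : Fin (n + 1), f' j * u ∈ S := fun j =>
    Algebra.subset_adjoin (R := k) (s := Set.range fun j : Fin (n + 1) => f' j * u) ⟨j, rfl⟩
  have huS : u ∈ S := by
    have h0u := hgen 0
    rwa [h0, one_mul] at h0u
  induction hc using Algebra.adjoin_induction with
  | mem x hx =>
    obtain ⟨j, rfl⟩ := hx
    exact ⟨1, by rw [pow_one]; exact hgen j⟩
  | algebraMap r =>
    exact ⟨0, by rw [pow_zero, mul_one]; exact S.algebraMap_mem r⟩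
  | add x y _ _ hx hy =>
    obtain ⟨D₁, h₁⟩ := hx
    obtain ⟨D₂, h₂⟩ := hy
    refine ⟨D₁ + D₂, ?_⟩
    rw [add_mul]
    refine add_mem ?_ ?_
    · rw [pow_add, ← mul_assoc]
      exact mul_mem h₁ (pow_mem huS _)
    · rw [add_comm D₁, pow_add, ← mul_assoc]
      exact mul_mem h₂ (pow_mem huS _)
  | mul x y _ _ hx hy =>
    obtain ⟨D₁, h₁⟩ := hx
    obtain ⟨D₂, h₂⟩ := hy
    refine ⟨D₁ + D₂, ?_⟩
    rw [pow_add, mul_mul_mul_comm]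
    exact mul_mem h₁ h₂

/-- **The chart subalgebras have fraction field `K`, are of finite type, and the `0`-th chart is the
affine coordinate ring.** For fields `k ⊆ K` and `f' : Fin (n + 1) → K` with `f' 0 = 1` such that
every `z ∈ K` is a quotient `a / b` of elements of `k[f']` (`b ≠ 0`), and an index `h` with
`f'_h ≠ 0`: the subalgebra `𝒞_h = k[f'_j · (f'_h)⁻¹ : j] ⊆ K` has `K` as field of fractions (pad
`a` and `b` by a common power of the generator `(f'_h)⁻¹ ∈ 𝒞_h`), is of finite type over `k`
(finitely many generators), and `𝒞_0 = k[f']` since its generators are `f'_j · 1⁻¹ = f'_j`.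
[folklore] -/
theorem tropicalLinks_chart_isFractionRing_of_frac : ∀ (k : Type) [Field k] (K : Type) [Field K] [Algebra k K] (n : ℕ) (f' : Fin (n + 1) → K), f' 0 = 1 → (∀ z : K, ∃ a b : K, a ∈ Algebra.adjoin k (Set.range f') ∧ b ∈ Algebra.adjoin k (Set.range f') ∧ b ≠ 0 ∧ z = a / b) → ∀ h : Fin (n + 1), f' h ≠ 0 → IsFractionRing ↥(Algebra.adjoin k (Set.range fun j : Fin (n + 1) => f' j * (f' h)⁻¹)) K ∧ Algebra.FiniteType k ↥(Algebra.adjoin k (Set.range fun j : Fin (n + 1) => f' j * (f' h)⁻¹)) ∧ Algebra.adjoin k (Set.range fun j : Fin (n + 1) => f' j * (f' 0)⁻¹) = Algebra.adjoin k (Set.range f') := by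
  intro k _ K _ _ n f' h0 hfrac h hh
  set u : K := (f' h)⁻¹ with hu
  set S : Subalgebra k K := Algebra.adjoin k (Set.range fun j : Fin (n + 1) => f' j * u) with hS
  refine ⟨?_, Algebra.FiniteType.adjoin_of_finite (Set.finite_range _), ?_⟩
  · -- fraction field: `u ∈ S`, `u ≠ 0`, and `k[f'] · u^D ⊆ S` elementwise
    have huS : u ∈ S := by
      have h0u : f' 0 * u ∈ S :=
        Algebra.subset_adjoin (R := k) (s := Set.range fun j : Fin (n + 1) => f' j * u) ⟨0, rfl⟩
      rwa [h0, one_mul] at h0u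
    have hu0 : u ≠ 0 := inv_ne_zero hh
    refine IsFractionRing.of_field S K fun z => ?_
    obtain ⟨a, b, ha, hb, -, rfl⟩ := hfrac z
    obtain ⟨D₁, h₁⟩ := tropicalLinks_chart_mul_inv_pow_mem k K n f' h0 h a ha
    obtain ⟨D₂, h₂⟩ := tropicalLinks_chart_mul_inv_pow_mem k K n f' h0 h b hb
    refine ⟨⟨_, mul_mem h₁ (pow_mem huS D₂)⟩, ⟨_, mul_mem h₂ (pow_mem huS D₁)⟩, ?_⟩
    change _ = a * u ^ D₁ * u ^ D₂ / (b * u ^ D₂ * u ^ D₁)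
    rw [mul_assoc, mul_assoc, ← pow_add, ← pow_add, add_comm D₂ D₁,
      mul_div_mul_right _ _ (pow_ne_zero _ hu0)]
  · -- the `0`-th chart: `f'_j · (f'_0)⁻¹ = f'_j`
    have hfun : (fun j : Fin (n + 1) => f' j * (f' 0)⁻¹) = f' := by
      funext j
      rw [h0, inv_one, mul_one]
    rw [hfun]

end Summit.ResolutionOfSingularities.ResolutionOfSingularities.Theorems
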